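import Summits.QuantumFields.YangMills.Theorems.FradkinShenkerFlowFiniteSusceptibilityWeakCouplingAxisIsotropy
import Literature.MathematicalPhysics.QuantumFieldTheory.WilsonAxisSymmetry
import Literature.MathematicalPhysics.QuantumFieldTheory.LatticeGaugeProofs
import HarnessLib

/-!
# Crux `NonSimplyConnectedLatticeGap` (stmt-QuantumFields-16405), route `ConvexGribovBody`,
# line `twist-equipartition-blindness` — stub `stub_sectorMixture` (MIX), auxiliary layer 2

Measure-theoretic transport lemmas for the sector mixture step, over the torus Wilson measure
`wilsonMeasure ρ β` on `GaugeConfig 4 L H` and a sector labelling `cls : GaugeConfig 4 L H → Option K`: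

* axis exchange (`configPerm σ`, interface clause X5 `cls ∘ configPerm σ = Option.map Ψ ∘ cls` with
  `Ψ` injective): the sector `{cls = some z}` is the `configPerm σ`-preimage of `{cls = some (Ψ z)}`
  (`mix_perm_preimage`), so the two sectors have the same Wilson weight (`mix_perm_measure`,
  from `wilsonMeasure_map_configPerm`) and sector integrals transport (`mix_perm_setIntegral`);
  the pulled-back observable `V ↦ A(π ∘ torusLift V)` composed with `configPerm σ` is the pull-back
  of the permuted species `permSpecies σ⁻¹ A` (`mix_perm_pullback`, via the registered sub-goal
  `mix_configPermZd_symm_apply` and `mix_comp_configPermZd`);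
* torus translations (`torusConfigShift t`, interface clause X6): sectors are translation
  invariant (`mix_shift_preimage`), sector integrals of translated observables agree
  (`mix_shift_setIntegral`, from `wilsonMeasure_map_torusConfigShift`), and the time translation
  `configShift` of the periodic lift is a torus translation (`mix_configShift_torusLift`);
* measurability / integrability / the crude bound `|∫_E F| ≤ M μ(E)` of pulled-back bounded
  observables (`mix_measurable_comp`, `mix_integrable_of_bound`, `mix_abs_setIntegral_le`).
-/

set_option autoImplicit false

noncomputable section

open MeasureTheory
open Literature.MathematicalPhysics.QuantumFieldTheory Literature.MathematicalPhysics.QuantumLattice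
open Summit.QuantumFields.YangMills.Theorems.FiniteSusceptibilityWeakCoupling.AxisIsotropy
  (permSpecies permSpecies_F)

namespace Summit.QuantumFields.YangMills.Theorems.NonSimplyConnectedLatticeGap

section Algebra

variable {G H : Type} [MeasurableSpace G] [MeasurableSpace H]

/-- Post-composition with a link-wise map commutes with the coordinate permutations of
`ℤ⁴`-configurations (both are re-indexings). -/
theorem mix_comp_configPermZd (f : H → G) (σ : Equiv.Perm (Fin 4)) (W : LGConfig 4 H) :
    (fun e => f (configPermZd σ W e)) = configPermZd σ (fun e => f (W e)) := by
  funext e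
  simp only [configPermZd_apply]

/-- `configPermZd σ⁻¹` undoes `configPermZd σ`. -/
theorem mix_configPermZd_symm_apply : ∀ {G : Type} [MeasurableSpace G] (σ : Equiv.Perm (Fin 4)) (U : Literature.MathematicalPhysics.QuantumLattice.LGConfig 4 G), Literature.MathematicalPhysics.QuantumFieldTheory.configPermZd σ.symm (Literature.MathematicalPhysics.QuantumFieldTheory.configPermZd σ U) = U := by
  intro G _ σ U
  funext e
  simp only [configPermZd_apply, Equiv.symm_symm, sitePermZd_symm_apply_apply,
    Equiv.symm_apply_apply]

/-- **Axis exchange of a pulled-back observable.** For the periodic lift of a permuted torus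
configuration, `(permSpecies σ⁻¹ A)(π ∘ torusLift (configPerm σ V)) = A(π ∘ torusLift V)`
(`configPermZd_torusLift` and the two re-indexing lemmas above). -/
theorem mix_perm_pullback [Group G] [Group H] (π : H →* G) (σ : Equiv.Perm (Fin 4)) (A : YMSpecies G) (L : ℕ)
    (V : GaugeConfig 4 L H) :
    (permSpecies σ.symm A).F (fun e => π (torusLift L (configPerm σ V) e)) =
      A.F (fun e => π (torusLift L V e)) := by
  rw [permSpecies_F, ← configPermZd_torusLift, mix_comp_configPermZd (⇑π) σ (torusLift L V),
    mix_configPermZd_symm_apply]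

/-- **The sector `{cls = some z}` is the `configPerm σ`-preimage of `{cls = some (Ψ z)}`** when
`cls ∘ configPerm σ = Option.map Ψ ∘ cls` with `Ψ` injective (interface clause X5). -/
theorem mix_perm_preimage {L : ℕ} (σ : Equiv.Perm (Fin 4)) {K : Type} (cls : GaugeConfig 4 L H → Option K)
    (Ψ : K → K) (hΨ : Function.Injective Ψ) (hcls : ∀ V, cls (configPerm σ V) = (cls V).map Ψ)
    (z : K) : (configPerm σ) ⁻¹' (cls ⁻¹' {some (Ψ z)}) = cls ⁻¹' {some z} := by
  ext V
  simp only [Set.mem_preimage, Set.mem_singleton_iff, hcls]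
  constructor
  · intro h
    exact Option.map_injective hΨ (h.trans rfl)
  · intro h
    rw [h]
    rfl

/-- **Sectors are translation invariant** (interface clause X6): `{cls ∘ torusConfigShift t ∈ s} =
{cls ∈ s}`. -/
theorem mix_shift_preimage {L : ℕ} {K : Type} (cls : GaugeConfig 4 L H → K)
    (hX6 : ∀ (v : Site 4 L) (V : GaugeConfig 4 L H), cls (fun e => V (e.1 + v, e.2)) = cls V)
    (t : Site 4 L) (s : Set K) : (torusConfigShift t) ⁻¹' (cls ⁻¹' s) = cls ⁻¹' s := by
  ext V
  simp only [Set.mem_preimage]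
  have h : (torusConfigShift t V : GaugeConfig 4 L H) = fun e => V (e.1 + -t, e.2) := by
    funext e
    rw [torusConfigShift_apply, sub_eq_add_neg]
  rw [h, hX6]

/-- **The time translation of the periodic lift is a torus translation**:
`configShift w (torusLift L V) = torusLift L (torusConfigShift (w mod L) V)`. -/
theorem mix_configShift_torusLift {L : ℕ} (w : Literature.Probability.LatticeModels.Site 4)
    (V : GaugeConfig 4 L H) :
    configShift w (torusLift L V) =
      torusLift L (torusConfigShift (Literature.Probability.LatticeModels.Torus.proj L w) V) :=
  congrFun (toTorusObservable_comp_configShift (G := H) L w id) V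

end Algebra

section Measure

variable {G H : Type} [Group G] [MeasurableSpace G] [Group H] [TopologicalSpace H]
  [IsTopologicalGroup H] [CompactSpace H] [MeasurableSpace H] [BorelSpace H]

/-- **Axis exchange preserves sector weights**: `μ̃ {cls = some (Ψ z)} = μ̃ {cls = some z}`
(`wilsonMeasure_map_configPerm` and `mix_perm_preimage`). -/
theorem mix_perm_measure {N L : ℕ} [NeZero L] (ρ : H →* Matrix (Fin N) (Fin N) ℂ) (hρ : Continuous ρ)
    (β : ℝ) (σ : Equiv.Perm (Fin 4)) {K : Type} (cls : GaugeConfig 4 L H → Option K) (Ψ : K → K)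
    (hΨ : Function.Injective Ψ) (hcls : ∀ V, cls (configPerm σ V) = (cls V).map Ψ)
    (hmeas : ∀ o, MeasurableSet (cls ⁻¹' {o})) (z : K) :
    (wilsonMeasure (d := 4) (L := L) ρ β) (cls ⁻¹' {some (Ψ z)}) =
      (wilsonMeasure (d := 4) (L := L) ρ β) (cls ⁻¹' {some z}) := by
  conv_lhs => rw [← wilsonMeasure_map_configPerm ρ hρ β σ]
  rw [Measure.map_apply (configPerm σ).measurable (hmeas _), mix_perm_preimage σ cls Ψ hΨ hcls z]

/-- **Axis exchange transports sector integrals**: if `g ∘ configPerm σ = f` then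
`∫_{cls = some (Ψ z)} g dμ̃ = ∫_{cls = some z} f dμ̃`. -/
theorem mix_perm_setIntegral {N L : ℕ} [NeZero L] (ρ : H →* Matrix (Fin N) (Fin N) ℂ)
    (hρ : Continuous ρ) (β : ℝ) (σ : Equiv.Perm (Fin 4)) {K : Type}
    (cls : GaugeConfig 4 L H → Option K) (Ψ : K → K) (hΨ : Function.Injective Ψ)
    (hcls : ∀ V, cls (configPerm σ V) = (cls V).map Ψ) (z : K) (f g : GaugeConfig 4 L H → ℝ)
    (hfg : ∀ V, g (configPerm σ V) = f V) :
    ∫ V in cls ⁻¹' {some (Ψ z)}, g V ∂(wilsonMeasure (d := 4) (L := L) ρ β) =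
      ∫ V in cls ⁻¹' {some z}, f V ∂(wilsonMeasure (d := 4) (L := L) ρ β) := by
  rw [← (measurePreserving_configPerm_wilsonMeasure ρ hρ β σ).setIntegral_preimage_emb
    (configPerm σ).measurableEmbedding g _, mix_perm_preimage σ cls Ψ hΨ hcls z]
  simp only [hfg]

/-- **Translated observables have the same sector integrals** on a translation-invariant set:
`∫_s g ∘ torusConfigShift t dμ̃ = ∫_s g dμ̃` (`wilsonMeasure_map_torusConfigShift`). -/
theorem mix_shift_setIntegral {N L : ℕ} [NeZero L] (ρ : H →* Matrix (Fin N) (Fin N) ℂ) (β : ℝ)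
    (t : Site 4 L) (s : Set (GaugeConfig 4 L H)) (hs : (torusConfigShift t) ⁻¹' s = s)
    (g : GaugeConfig 4 L H → ℝ) :
    ∫ V in s, g (torusConfigShift t V) ∂(wilsonMeasure (d := 4) (L := L) ρ β) =
      ∫ V in s, g V ∂(wilsonMeasure (d := 4) (L := L) ρ β) := by
  have hmp : MeasurePreserving (torusConfigShift t) (wilsonMeasure (d := 4) (L := L) ρ β)
      (wilsonMeasure (d := 4) (L := L) ρ β) :=
    ⟨(torusConfigShift t).measurable, wilsonMeasure_map_torusConfigShift ρ β t⟩
  have h := hmp.setIntegral_preimage_emb (torusConfigShift t).measurableEmbedding g s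
  rwa [hs] at h

variable [TopologicalSpace G] [BorelSpace G]

omit [IsTopologicalGroup H] [CompactSpace H] in
/-- Pulled-back observables `V ↦ F (π ∘ T V)` are measurable for continuous `π`, measurable `T`, `F`. -/
theorem mix_measurable_comp (π : H →* G) (hπ : Continuous π) {L : ℕ}
    {T : GaugeConfig 4 L H → LGConfig 4 H} (hT : Measurable T) (F : LGConfig 4 G → ℝ)
    (hF : Measurable F) : Measurable fun V : GaugeConfig 4 L H => F (fun e => π (T V e)) :=
  hF.comp (measurable_pi_lambda _ fun e => hπ.measurable.comp ((measurable_pi_apply e).comp hT))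

/-- A bounded measurable real function is integrable for the (probability) torus Wilson measure. -/
theorem mix_integrable_of_bound {N L : ℕ} [NeZero L] (ρ : H →* Matrix (Fin N) (Fin N) ℂ)
    (hρ : Continuous ρ) (β : ℝ) (f : GaugeConfig 4 L H → ℝ) (hf : Measurable f) (M : ℝ)
    (hM : ∀ V, |f V| ≤ M) : Integrable f (wilsonMeasure (d := 4) (L := L) ρ β) := by
  haveI := isProbabilityMeasure_wilsonMeasure (d := 4) (L := L) ρ hρ β
  exact Integrable.of_bound hf.aestronglyMeasurable M
    (ae_of_all _ fun V => (Real.norm_eq_abs _).trans_le (hM V))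

/-- The crude sector bound `|∫_E f dμ̃| ≤ M μ̃(E)` for `|f| ≤ M`. -/
theorem mix_abs_setIntegral_le {N L : ℕ} [NeZero L] (ρ : H →* Matrix (Fin N) (Fin N) ℂ)
    (hρ : Continuous ρ) (β : ℝ) (f : GaugeConfig 4 L H → ℝ) (M : ℝ) (hM : ∀ V, |f V| ≤ M)
    (E : Set (GaugeConfig 4 L H)) :
    |∫ V in E, f V ∂(wilsonMeasure (d := 4) (L := L) ρ β)| ≤
      M * ((wilsonMeasure (d := 4) (L := L) ρ β) E).toReal := by
  haveI := isProbabilityMeasure_wilsonMeasure (d := 4) (L := L) ρ hρ β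
  have h := norm_setIntegral_le_of_norm_le_const (μ := wilsonMeasure (d := 4) (L := L) ρ β)
    (s := E) (f := f) (measure_lt_top _ _) fun V _ => (Real.norm_eq_abs _).trans_le (hM V)
  rwa [Real.norm_eq_abs] at h

end Measure

end Summit.QuantumFields.YangMills.Theorems.NonSimplyConnectedLatticeGap

end
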